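import Summits.CriticalPhenomena.SAWScalingLimit.Theorems.SAWRenewalTightnessSubseqIdentificationTiltedBracketMoment
import Summits.CriticalPhenomena.SAWScalingLimit.Theorems.SAWRenewalTightnessSubseqIdentificationTiltedProductCell
import HarnessLib

/-!
# The tilted martingale identities (line `boundary-area-law`, RS5b′/T2, Σ): the frozen interior estimate

Line `boundary-area-law` of the crux `SubseqIdentification` (stmt-CriticalPhenomena-0783), restriction
reshape (lead c4, r-c4-5), stub `stub_tiltedBracketMartingale` (Σ) = the bracket half of step (T2) of
the tilted [LSW] Theorem 6.5 (G. F. Lawler, O. Schramm, W. Werner, *Conformal restriction: the chordal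
case*, J. Amer. Math. Soc. **16** (2003), §5 (5.1)–(5.3) and Prop. 5.3). Sequel of
`…TiltedBracketMoment`, the interior input of the bracket cell estimate (`…TiltedBracketCell`,
`…TiltedBracketEstimate`): freezing the past at `u` against an `𝓕_u`-measurable weight `g ∈ [0, 1]`
supported on `{u < imgLocTimeK n}` in the functional `(ΔW̃ · Ŷ′_{α/2,λ/2})² = (ΔW̃)² Ŷ′_{α,λ}`,

  `|E[g · ((ΔW̃)² Ŷ′ − κ Φ′_{B_u}(0)² Φ′_{B_u}(0)^α h)]| ≤ C h√h`

(`exists_abs_integral_mul_brkSq_le`, after `…TiltedProductInterior`): on the support of `g` the past is alive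
with `A_u − W_u` in the level-`n` controlled class and driver bounded by `n + 1`, so the frozen conditional
second moment is `κ d² d^α h + O(h√h)` by `exists_abs_integral_frozenBrk_sq_le`, uniformly — the one-step
form of "`d⟨W̃⟩ = κ h′(W)² dt`, multiplied by `Y`".

References: [LSW] §5 (5.1)–(5.3), Prop. 5.3. No named fact is used.
-/

noncomputable section

open MeasureTheory Filter Topology Set Metric Function
open scoped NNReal ENNReal
open Literature.Probability.RandomPlanarGeometry
open Literature.Probability.Process (preWienerMeasure runSup runSup_nonneg integrable_runSup integrable_runSup_sq)

namespace Summit.CriticalPhenomena.SAWScalingLimit.Theorems.SubseqIdentification.BoundaryAreaLaw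

open Loewner PathOps

variable [MeasurableSpace C(ℝ≥0, ℝ)] [BorelSpace C(ℝ≥0, ℝ)]
variable {κ : ℝ≥0} {α lam : ℝ} {A : Set ℂ}

/-! ### The frozen interior estimate of the bracket cell -/

section Interior

set_option maxHeartbeats 400000 in
/-- **The second-moment term of the bracket cell is `O(h√h)` in expectation** ([LSW] §5, one step, frozen
past): for `α = (6−κ)/(2κ)`, `λ = (8−3κ)(6−κ)/(2κ)`, `0 < κ ≤ 8/3`, `A ⊆ B̄(0, R)` and a horizon `t₁` there is
`C ≥ 0` such that for `u ≤ t₁`, `0 < h ≤ 3c₀²/256` (`c₀ = (cₙ/2)(cₙ/16)/4000`), `λ h · massBdCell n ≤ 1`, and every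
`𝓕_u`-measurable weight `g : Ω → [0, 1]` supported on `{u < imgLocTimeK n}`,

  `|E[g · ((ΔW̃)² Ŷ′ − κ Φ′_{B_u}(0)² Φ′_{B_u}(0)^α h)]| ≤ C h √h`.

Freeze the past at `u` (`integral_mul_eq_integral_mul_concat_of_integrable`) in the functional
`(ΔW̃ · Ŷ′_{α/2,λ/2})² = (ΔW̃)² Ŷ′_{α,λ}`; on the support of `g` the past is alive with `A_u − W_u` in the
level-`n` class and driver bounded by `n + 1`, so the frozen conditional second moment is
`κ (d·d^{α/2})² h + O(h√h) = κ d² d^α h + O(h√h)` by `exists_abs_integral_frozenBrk_sq_le`, uniformly.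
[cite: LawlerSchrammWerner2003Restriction, §5 (5.1)–(5.3) and Prop. 5.3] -/
theorem exists_abs_integral_mul_brkSq_le (hκ0 : 0 < κ) (hκ : κ ≤ 8 / 3) (hαdef : α = (6 - κ) / (2 * κ))
    (hlamdef : lam = (8 - 3 * κ) * (6 - κ) / (2 * κ)) (hA : IsStarHull A) (hne : A.Nonempty) (n : ℕ) {R : ℝ}
    (hR0 : 0 < R) (hAR : A ⊆ closedBall (0 : ℂ) R) (t₁ : ℝ≥0) :
    ∃ C : ℝ, 0 ≤ C ∧ ∀ (u h : ℝ≥0), u ≤ t₁ → 0 < h →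
      (h : ℝ) ≤ 3 * (locLevel n / 2 * (locLevel n / 16) / 4000) ^ 2 / 256 → lam * (h * massBdCell n) ≤ 1 →
      ∀ {g : (ℝ≥0 → ℝ) → ℝ}, Measurable[brownianFiltration u] g → (∀ ω, g ω ∈ Icc (0 : ℝ) 1) →
        (∀ ω, g ω ≠ 0 → (u : WithTop ℝ≥0) < imgLocTimeK κ hA hne n ω) →
        |∫ ω, g ω * ((imageDrvFnK κ A (u + h) (brownianCPath ω) - imageDrvFnK κ A u (brownianCPath ω)) ^ 2 *
              (DFnK κ A (u + h) (brownianCPath ω) ^ α * Real.exp (-(lam * JFnK κ A u h (brownianCPath ω)))) -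
            κ * starDeriv (slidHull (drvK κ (brownianCPath ω)) A u) ^ 2 *
              starDeriv (slidHull (drvK κ (brownianCPath ω)) A u) ^ α * h) ∂preWienerMeasure| ≤ C * h * Real.sqrt h := by
  -- adapted from …TiltedProductInterior (`exists_abs_integral_mul_prod_le`)
  haveI := isProbabilityMeasure_preWienerMeasure'
  obtain ⟨hαpos, hlam0⟩ := exponents_pos hκ hαdef hlamdef hκ0
  obtain ⟨hc0, hc1⟩ := locLevel_pos_le n
  set c := locLevel n with hc
  set δ₀ : ℝ := c / 2 with hδ₀def
  set ρ₀ : ℝ := c / 16 with hρ₀def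
  have hδ0 : 0 < δ₀ := by positivity
  have hρ₀ : 0 < ρ₀ := by positivity
  have hρ1 : ρ₀ ≤ 1 := by rw [hρ₀def]; linarith
  have hκr : (0 : ℝ) ≤ κ := κ.coe_nonneg
  have hα2 : 0 < α / 2 := by positivity
  have hlam2 : 0 ≤ lam / 2 := by positivity
  obtain ⟨K, hK0, hK⟩ := exists_abs_integral_frozenBrk_sq_le hκ0 hκ hA hne hR0 hAR hδ0 hρ₀ hρ1 hα2 hlam2
  set M₀' : ℝ := (3482 * ((n : ℝ) + 1) + (15080 * Real.sqrt ((t₁ : ℝ) + 1) + 1160 * R)) + 6 * (α / 2) / ρ₀ with hM₀'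
  have hM₀'0 : 0 ≤ M₀' := by positivity
  refine ⟨K * (1 + M₀' ^ 2), by positivity, ?_⟩
  intro u h hut hh0 hh hlamh g hgm hg01 hsupp
  have hh1 : (h : ℝ) ≤ 1 := by
    have h1 : 3 * (locLevel n / 2 * (locLevel n / 16) / 4000) ^ 2 / 256 ≤ 1 := by
      have : locLevel n / 2 * (locLevel n / 16) / 4000 ≤ 1 := by rw [div_le_one (by norm_num)]; nlinarith
      have h2 : 0 ≤ locLevel n / 2 * (locLevel n / 16) / 4000 := by positivity
      nlinarith
    exact hh.trans h1
  have hhs0 : 0 ≤ (h : ℝ) * Real.sqrt h := by positivity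
  have hlamh2 : lam / 2 * (h * massBound δ₀ ρ₀) ≤ 1 := by
    have h0 : 0 ≤ (h : ℝ) * massBound δ₀ ρ₀ := by
      have : 0 ≤ massBound δ₀ ρ₀ := by rw [massBound]; positivity
      positivity
    have : lam / 2 * (h * massBound δ₀ ρ₀) ≤ lam * (h * massBound δ₀ ρ₀) := by nlinarith
    exact this.trans hlamh
  -- the functional `(ΔW̃ · Ŷ′_{α/2,λ/2})²` and its value `(ΔW̃)² Ŷ′_{α,λ}` along a path
  set Φ : C(ℝ≥0, ℝ) → ℝ := fun υ ↦ ((imageDrvFnK κ A (u + h) υ - imageDrvFnK κ A u υ) *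
    (DFnK κ A (u + h) υ ^ (α / 2) * Real.exp (-(lam / 2 * JFnK κ A u h υ)))) ^ 2 with hΦ
  have hΦeq : ∀ υ, Φ υ = (imageDrvFnK κ A (u + h) υ - imageDrvFnK κ A u υ) ^ 2 *
      (DFnK κ A (u + h) υ ^ α * Real.exp (-(lam * JFnK κ A u h υ))) := fun υ ↦ by
    obtain ⟨-, -, e0, -⟩ := DFnK_eq (κ := κ) (A := A) (u + h) υ
    have e1 : (DFnK κ A (u + h) υ ^ (α / 2)) ^ 2 = DFnK κ A (u + h) υ ^ α := by
      rw [← Real.rpow_natCast, ← Real.rpow_mul e0]; norm_num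
    have e2 : Real.exp (-(lam / 2 * JFnK κ A u h υ)) ^ 2 = Real.exp (-(lam * JFnK κ A u h υ)) := by
      rw [sq, ← Real.exp_add]; congr 1; ring
    rw [hΦ]; simp only
    rw [mul_pow, mul_pow, e1, e2]
  obtain ⟨hΔm, -, iΔ2⟩ := integrable_imageDrv_subK (κ := κ) hA hne hR0 hAR u h
  have hYm : Measurable fun υ : C(ℝ≥0, ℝ) ↦ DFnK κ A (u + h) υ ^ (α / 2) * Real.exp (-(lam / 2 * JFnK κ A u h υ)) :=
    ((measurable_DFnK hA hne (u + h)).pow_const _).mul ((measurable_JFnK hA hne u h).const_mul (lam / 2)).neg.exp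
  have hY01 : ∀ υ, 0 ≤ DFnK κ A (u + h) υ ^ α * Real.exp (-(lam * JFnK κ A u h υ)) ∧
      DFnK κ A (u + h) υ ^ α * Real.exp (-(lam * JFnK κ A u h υ)) ≤ 1 := fun υ ↦ by
    obtain ⟨-, -, e0, e1⟩ := DFnK_eq (κ := κ) (A := A) (u + h) υ
    have c1 : Real.exp (-(lam * JFnK κ A u h υ)) ≤ 1 := by
      rw [Real.exp_le_one_iff, neg_nonpos]; exact mul_nonneg hlam0 (JFnK_nonneg hA u h _)
    exact ⟨mul_nonneg (Real.rpow_nonneg e0 _) (Real.exp_pos _).le,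
      mul_le_one₀ (Real.rpow_le_one e0 e1 hαpos.le) (Real.exp_pos _).le c1⟩
  have hΦm : Measurable Φ := (hΔm.mul hYm).pow_const 2
  have hΦi : Integrable (fun ω ↦ Φ (brownianCPath ω)) preWienerMeasure := by
    refine iΔ2.mono' (hΦm.comp measurable_brownianCPath).aestronglyMeasurable (Eventually.of_forall fun ω ↦ ?_)
    rw [Real.norm_eq_abs, hΦeq, abs_mul, abs_of_nonneg (sq_nonneg _), abs_of_nonneg (hY01 _).1]
    exact mul_le_of_le_one_right (sq_nonneg _) (hY01 _).2
  -- the `d`-term is measurable on the support of `g`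
  have hgm' : Measurable g := hgm.mono (brownianFiltration.le u) le_rfl
  have hg1 : ∀ ω, |g ω| ≤ 1 := fun ω ↦ by rw [abs_of_nonneg (hg01 ω).1]; exact (hg01 ω).2
  have hg1' : ∀ᵐ ω ∂preWienerMeasure, ‖g ω‖ ≤ 1 := Eventually.of_forall fun ω ↦ by rw [Real.norm_eq_abs]; exact hg1 ω
  set D : (ℝ≥0 → ℝ) → ℝ := fun ω ↦ (κ : ℝ) * starDeriv (slidHull (drvK κ (brownianCPath ω)) A u) ^ 2 *
    starDeriv (slidHull (drvK κ (brownianCPath ω)) A u) ^ α * h with hD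
  have hD01 : ∀ ω, |D ω| ≤ κ * h := fun ω ↦ by
    obtain ⟨hd0, hd1⟩ := starDeriv_pos_le_one (slidHull (drvK κ (brownianCPath ω)) A u)
    rw [hD]; simp only
    rw [abs_mul, abs_mul, abs_mul, abs_of_nonneg hκr, abs_of_nonneg (sq_nonneg _), abs_of_nonneg (Real.rpow_nonneg hd0.le _),
      abs_of_nonneg h.coe_nonneg]
    have : (κ : ℝ) * starDeriv (slidHull (drvK κ (brownianCPath ω)) A u) ^ 2 * starDeriv (slidHull (drvK κ (brownianCPath ω)) A u) ^ α ≤ κ := by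
      have := mul_le_one₀ (pow_le_one₀ (n := 2) hd0.le hd1) (Real.rpow_nonneg hd0.le α) (Real.rpow_le_one hd0.le hd1 hαpos.le)
      calc _ = (κ : ℝ) * (starDeriv (slidHull (drvK κ (brownianCPath ω)) A u) ^ 2 * starDeriv (slidHull (drvK κ (brownianCPath ω)) A u) ^ α) := by ring
        _ ≤ κ * 1 := mul_le_mul_of_nonneg_left this hκr
        _ = κ := mul_one _
    exact mul_le_mul_of_nonneg_right this h.coe_nonneg
  have hgD : (fun ω ↦ g ω * D ω) = fun ω ↦ g ω * ((κ : ℝ) * DFnK κ A u (brownianCPath ω) ^ 2 * DFnK κ A u (brownianCPath ω) ^ α * h) := by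
    funext ω
    by_cases hg0 : g ω = 0
    · rw [hg0, zero_mul, zero_mul]
    · obtain ⟨halive, -⟩ := controlled_of_lt_locTimeK (lt_of_lt_of_le (hsupp ω hg0) (imgLocTimeK_le_locTimeK n ω))
      rw [hD]; simp only; rw [(DFnK_eq (κ := κ) (A := A) u (brownianCPath ω)).1 halive]
  have igD : Integrable (fun ω ↦ g ω * D ω) preWienerMeasure := by
    have hm : Measurable fun ω ↦ g ω * D ω := by
      rw [hgD]
      exact hgm'.mul (((measurable_const.mul (((measurable_DFnK hA hne u).comp measurable_brownianCPath).pow_const _)).mul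
        (((measurable_DFnK hA hne u).comp measurable_brownianCPath).pow_const _)).mul measurable_const)
    refine (integrable_const ((κ : ℝ) * h)).mono' hm.aestronglyMeasurable (Eventually.of_forall fun ω ↦ ?_)
    rw [Real.norm_eq_abs, abs_mul]
    calc |g ω| * |D ω| ≤ 1 * (κ * h) := mul_le_mul (hg1 ω) (hD01 ω) (abs_nonneg _) zero_le_one
      _ = κ * h := one_mul _
  -- freezing
  obtain ⟨iΘ, hfr⟩ := integral_mul_eq_integral_mul_concat_of_integrable hgm hg01 hΦm hΦi
  have igΦ : Integrable (fun ω ↦ g ω * Φ (brownianCPath ω)) preWienerMeasure := hΦi.bdd_mul hgm'.aestronglyMeasurable hg1'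
  have igΘ := iΘ.bdd_mul hgm'.aestronglyMeasurable hg1'
  have hsplit : ∫ ω, g ω * ((imageDrvFnK κ A (u + h) (brownianCPath ω) - imageDrvFnK κ A u (brownianCPath ω)) ^ 2 *
        (DFnK κ A (u + h) (brownianCPath ω) ^ α * Real.exp (-(lam * JFnK κ A u h (brownianCPath ω)))) -
        κ * starDeriv (slidHull (drvK κ (brownianCPath ω)) A u) ^ 2 * starDeriv (slidHull (drvK κ (brownianCPath ω)) A u) ^ α * h)
        ∂preWienerMeasure =
      ∫ ω, g ω * (∫ ω₂, Φ (concat u (stop u (brownianCPath ω), brownianCPath ω₂)) ∂preWienerMeasure - D ω) ∂preWienerMeasure := by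
    have e1 : (fun ω ↦ g ω * ((imageDrvFnK κ A (u + h) (brownianCPath ω) - imageDrvFnK κ A u (brownianCPath ω)) ^ 2 *
        (DFnK κ A (u + h) (brownianCPath ω) ^ α * Real.exp (-(lam * JFnK κ A u h (brownianCPath ω)))) -
        κ * starDeriv (slidHull (drvK κ (brownianCPath ω)) A u) ^ 2 * starDeriv (slidHull (drvK κ (brownianCPath ω)) A u) ^ α * h)) =
        fun ω ↦ g ω * Φ (brownianCPath ω) - g ω * D ω := by
      funext ω; rw [hΦeq, hD]; simp only; ring
    have e2 : (fun ω ↦ g ω * (∫ ω₂, Φ (concat u (stop u (brownianCPath ω), brownianCPath ω₂)) ∂preWienerMeasure - D ω)) =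
        fun ω ↦ g ω * (∫ ω₂, Φ (concat u (stop u (brownianCPath ω), brownianCPath ω₂)) ∂preWienerMeasure) - g ω * D ω := by
      funext ω; ring
    rw [e1, e2, integral_sub igΦ igD, integral_sub igΘ igD, hfr]
  rw [hsplit]
  -- the pointwise bound of the frozen conditional second moment on the support of `g`
  have hpt : ∀ ω, |g ω * (∫ ω₂, Φ (concat u (stop u (brownianCPath ω), brownianCPath ω₂)) ∂preWienerMeasure - D ω)| ≤
      K * (1 + M₀' ^ 2) * h * Real.sqrt h := by
    intro ω
    by_cases hg0 : g ω = 0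
    · rw [hg0, zero_mul, abs_zero]; positivity
    have hu := hsupp ω hg0
    obtain ⟨halive, -, -, hd, hm⟩ := controlled_of_lt_locTimeK (lt_of_lt_of_le hu (imgLocTimeK_le_locTimeK n ω))
    set B := slidHull (drvK κ (brownianCPath ω)) A u with hBdef
    have hB : IsStarHull B := Loewner.isStarHull_slidHull_of_disjoint (continuous_drvK κ _) hA halive
    have hδ : 2 * δ₀ ≤ starDeriv B := by rw [hδ₀def]; linarith
    have hBρ : Disjoint (ball (0 : ℂ) (16 * ρ₀)) B := by
      rw [hρ₀def, show 16 * (c / 16) = c by ring]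
      exact disjoint_ball_infDist.mono_left (ball_subset_ball hm.le)
    have hN0 : (0 : ℝ) ≤ (n : ℝ) + 1 := by positivity
    have hN : ∀ s : ℝ≥0, s ≤ u → |drvK κ (brownianCPath ω) s| ≤ (n : ℝ) + 1 := fun s hs ↦
      abs_drvK_le_of_le_imgLocTimeK ((WithTop.coe_le_coe.2 hs).trans hu.le)
    have key := hK halive hBρ hδ hh0 hh hN0 hN hlamh2
    obtain ⟨hd0, hd1, -⟩ := starDeriv_spec hB
    -- `(d · d^{α/2})² = d² d^α`
    have hdd : (κ : ℝ) * (starDeriv B * starDeriv B ^ (α / 2)) ^ 2 * h = D ω := by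
      have e1 : (starDeriv B ^ (α / 2)) ^ 2 = starDeriv B ^ α := by
        rw [← Real.rpow_natCast, ← Real.rpow_mul hd0.le]; norm_num
      rw [hD]; simp only; rw [mul_pow, e1]; ring
    rw [hdd] at key
    -- uniformity in `(N, u) ≤ (n + 1, t₁)`
    have hsq : Real.sqrt ((u + h : ℝ≥0) : ℝ) ≤ Real.sqrt ((t₁ : ℝ) + 1) :=
      Real.sqrt_le_sqrt (by push_cast; exact add_le_add (by exact_mod_cast hut) hh1)
    have m0 : 0 ≤ (3482 * ((n : ℝ) + 1) + (15080 * Real.sqrt ((u + h : ℝ≥0) : ℝ) + 1160 * R)) + 6 * (α / 2) / ρ₀ := by positivity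
    have m2 : (3482 * ((n : ℝ) + 1) + (15080 * Real.sqrt ((u + h : ℝ≥0) : ℝ) + 1160 * R)) + 6 * (α / 2) / ρ₀ ≤ M₀' := by
      rw [hM₀']; linarith [mul_le_mul_of_nonneg_left hsq (by norm_num : (0 : ℝ) ≤ 15080)]
    have m3 : K * (1 + ((3482 * ((n : ℝ) + 1) + (15080 * Real.sqrt ((u + h : ℝ≥0) : ℝ) + 1160 * R)) + 6 * (α / 2) / ρ₀) ^ 2) ≤
        K * (1 + M₀' ^ 2) := mul_le_mul_of_nonneg_left (by nlinarith [pow_le_pow_left₀ m0 m2 2]) hK0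
    rw [abs_mul]
    calc |g ω| * |∫ ω₂, Φ (concat u (stop u (brownianCPath ω), brownianCPath ω₂)) ∂preWienerMeasure - D ω|
        ≤ 1 * (K * (1 + ((3482 * ((n : ℝ) + 1) + (15080 * Real.sqrt ((u + h : ℝ≥0) : ℝ) + 1160 * R)) + 6 * (α / 2) / ρ₀) ^ 2) *
            h * Real.sqrt h) := mul_le_mul (hg1 ω) key (abs_nonneg _) zero_le_one
      _ ≤ _ := by
          rw [one_mul, mul_assoc, mul_assoc _ (h : ℝ)]
          exact mul_le_mul_of_nonneg_right m3 hhs0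
  have igd : Integrable (fun ω ↦ g ω * (∫ ω₂, Φ (concat u (stop u (brownianCPath ω), brownianCPath ω₂)) ∂preWienerMeasure - D ω))
      preWienerMeasure := by
    have : (fun ω ↦ g ω * (∫ ω₂, Φ (concat u (stop u (brownianCPath ω), brownianCPath ω₂)) ∂preWienerMeasure - D ω)) =
        fun ω ↦ g ω * (∫ ω₂, Φ (concat u (stop u (brownianCPath ω), brownianCPath ω₂)) ∂preWienerMeasure) - g ω * D ω := by
      funext ω; ring
    rw [this]; exact igΘ.sub igD
  calc |∫ ω, g ω * (∫ ω₂, Φ (concat u (stop u (brownianCPath ω), brownianCPath ω₂)) ∂preWienerMeasure - D ω) ∂preWienerMeasure|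
      ≤ ∫ ω, |g ω * (∫ ω₂, Φ (concat u (stop u (brownianCPath ω), brownianCPath ω₂)) ∂preWienerMeasure - D ω)| ∂preWienerMeasure :=
        abs_integral_le_integral_abs
    _ ≤ ∫ _, K * (1 + M₀' ^ 2) * h * Real.sqrt h ∂preWienerMeasure := integral_mono igd.abs (integrable_const _) hpt
    _ = _ := by simp

end Interior

section Registered

omit [MeasurableSpace C(ℝ≥0, ℝ)] [BorelSpace C(ℝ≥0, ℝ)] in
/-- **Registered form** (explicit binders) of `exists_abs_integral_mul_brkSq_le`: the second-moment term of
the bracket cell is `O(h√h)` in expectation, uniformly over `𝓕_u`-weights in `[0, 1]` supported on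
`{u < imgLocTimeK n}`, `u ≤ t₁`. [cite: LawlerSchrammWerner2003Restriction, §5 (5.1)–(5.3) and Prop. 5.3] -/
theorem exists_abs_integral_mul_brkSq_le_registered :
    ∀ (κ : ℝ≥0) (α lam : ℝ), 0 < κ → κ ≤ 8 / 3 → α = (6 - κ) / (2 * κ) → lam = (8 - 3 * κ) * (6 - κ) / (2 * κ) →
      ∀ (A : Set ℂ) (hA : IsStarHull A) (hne : A.Nonempty) (n : ℕ) (R : ℝ), 0 < R → A ⊆ closedBall (0 : ℂ) R →
      ∀ (t₁ : ℝ≥0), ∃ C : ℝ, 0 ≤ C ∧ ∀ (u h : ℝ≥0), u ≤ t₁ → 0 < h →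
        (h : ℝ) ≤ 3 * (locLevel n / 2 * (locLevel n / 16) / 4000) ^ 2 / 256 → lam * (h * massBdCell n) ≤ 1 →
        ∀ (g : (ℝ≥0 → ℝ) → ℝ), Measurable[brownianFiltration u] g → (∀ ω, g ω ∈ Icc (0 : ℝ) 1) →
          (∀ ω, g ω ≠ 0 → (u : WithTop ℝ≥0) < imgLocTimeK κ hA hne n ω) →
          |∫ ω, g ω * ((imageDrvFnK κ A (u + h) (brownianCPath ω) - imageDrvFnK κ A u (brownianCPath ω)) ^ 2 *
                (DFnK κ A (u + h) (brownianCPath ω) ^ α * Real.exp (-(lam * JFnK κ A u h (brownianCPath ω)))) -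
              κ * starDeriv (Loewner.slidHull (drvK κ (brownianCPath ω)) A u) ^ 2 *
                starDeriv (Loewner.slidHull (drvK κ (brownianCPath ω)) A u) ^ α * h) ∂preWienerMeasure| ≤ C * h * Real.sqrt h := by
  intro κ α lam hκ0 hκ hαdef hlamdef A hA hne n R hR0 hAR t₁
  letI : MeasurableSpace C(ℝ≥0, ℝ) := borel _
  haveI : BorelSpace C(ℝ≥0, ℝ) := ⟨rfl⟩
  obtain ⟨C, hC0, hC⟩ := exists_abs_integral_mul_brkSq_le hκ0 hκ hαdef hlamdef hA hne n hR0 hAR t₁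
  exact ⟨C, hC0, fun u h hut hh0 hh hlamh g hgm hg01 hsupp ↦ hC u h hut hh0 hh hlamh hgm hg01 hsupp⟩

end Registered

end Summit.CriticalPhenomena.SAWScalingLimit.Theorems.SubseqIdentification.BoundaryAreaLaw

end
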